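import Mathlib
import HarnessLib
import Summits.Ventures.LatticeQCDFlow.Scoring.ChainTimeAverage
import Summits.Ventures.LatticeQCDFlow.Scoring.SectorBottleneckFloor

/-!
# The freezing window, on path space: a stationary run of `N + 1` samples of an exact sampler stays
# inside a sector `A` with probability `≥ π(A) − N·Φ` — and then the sector-weight estimate is off by
# `1 − π(A)`; for the flow sampler `Φ ≤ π(A) q(Aᶜ)`

HONEST FRAMING: exact (Metropolis-corrected) sampling algorithms for lattice gauge theory;
figures of merit are autocorrelation/cost numbers at stated couplings and volumes; no
continuum-physics claim.

Venture `LatticeQCDFlow` (cell pub-lqcd), topic `Scoring`; FANOUT row 8 (`s0-cpn-nemc`, GEN-13).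
NEW WORK of the cell, not a published result; no definition is introduced.  The row's sector files
price topological freezing on the autocorrelation side (`Scoring/SectorBottleneckFloor.lean`:
`τ_int(1_A) ≥ a(1−a)/Φ − 1/2`; `Scoring/SectorLinearLaw.lean`: `ρ_t(1_A) ≥ 1 − tΦ/(a(1−a))`); the
confidence files (`Scoring/ChainHoeffding.lean`, `Scoring/ChainConfidenceInterval.lean`) give UPPER
bounds on error probabilities.  This file is the matching LOWER bound on path space, for EVERY exact
sampler (no reversibility, no Doeblin): by a first-exit union bound, the stationary chain
(`Scoring/ChainTimeAverage.lean`: `chain_marginal`, `chain_autocov` for Mathlib's `Kernel.trajMeasure`)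
started in `π` stays in `A` for `N + 1` consecutive samples with probability at least `π(A) − N Φ`,
`Φ = π(A) − ∫_A κ(x, A) dπ = (π ⊗ₘ κ)(A ×ˢ Aᶜ)` the stationary exit flux
(`Scoring/SectorBottleneckFloor.flux_eq_compProd`); on that event the time average of `1_A` equals `1`.
For the flow-MCMC kernel, `Φ ≤ π(A) q(Aᶜ)` (`Scoring/SectorBottleneckFloor.indepMH_flux_le`).
Nothing is cited as a fact.

## Content (`κ` Markov with invariant probability law `π`; `A` measurable, `a = π(A)`,
## `s = ∫_A κ(x, A) dπ`, `Φ = a − s`; `P_π` the trajectory law started in `π`)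

* `one_sub_prod_indicator_le` — pointwise first-exit bound:
  `1 − Π_{i≤N} 1_A(x_i) ≤ (1 − 1_A(x_0)) + Σ_{i<N} 1_A(x_i)(1 − 1_A(x_{i+1}))`;
* `chain_exitPair_eq_flux` — `E_π[1_A(X_i)(1 − 1_A(X_{i+1}))] = Φ` for every `i`;
* **`chain_stay_ge`** — `P_π(X_0 ∈ A, …, X_N ∈ A) ≥ a − N Φ`;
* **`chain_freezing_window`** — `P_π(|(1/(N+1)) Σ_{i≤N} 1_A(X_i) − a| ≥ 1 − a) ≥ a − N Φ`: unless
  `N ≳ a/Φ`, the sector-weight estimate of a stationary run is wrong by `1 − a` with the stated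
  probability — no error bar computed from such a run can be honest;
* **`indepMH_freezing_window`** — for the flow-MCMC kernel `indepMH q w` with `π = w · q`:
  `P_π(… ≥ 1 − a) ≥ a (1 − N q(Aᶜ))` — a model that proposes the complement of the sector with
  probability `q(Aᶜ)` freezes a stationary run of length `N + 1 ≤ 1/q(Aᶜ)`.

NOT CLAIMED: any `Φ`, `q(Aᶜ)` or sector for a concrete sampler (measured / theory-2's separating
sets); non-stationary starts (a start inside `A` only helps the freezing); that the window is sharp.
-/

noncomputable section

namespace Summit.Ventures.LatticeQCDFlow.Scoring

open MeasureTheory ProbabilityTheory Filter Finset Preorder Set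
open Summit.Ventures.LatticeQCDFlow.Exactness
open scoped ENNReal

variable {Ω : Type*} [MeasurableSpace Ω]

/-! ### The first-exit union bound, pointwise -/

section Pointwise

omit [MeasurableSpace Ω] in
/-- `1 − Π_{i≤N} 1_A(x_i) ≤ (1 − 1_A(x_0)) + Σ_{i<N} 1_A(x_i)(1 − 1_A(x_{i+1}))`. -/
theorem one_sub_prod_indicator_le (A : Set Ω) (x : ℕ → Ω) : ∀ N : ℕ,
    1 - ∏ i ∈ Finset.range (N + 1), A.indicator (1 : Ω → ℝ) (x i)
      ≤ (1 - A.indicator (1 : Ω → ℝ) (x 0))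
        + ∑ i ∈ Finset.range N,
            A.indicator (1 : Ω → ℝ) (x i) * (1 - A.indicator (1 : Ω → ℝ) (x (i + 1)))
  | 0 => by simp
  | N + 1 => by
    have IH := one_sub_prod_indicator_le A x N
    have hnn : ∀ y, 0 ≤ A.indicator (1 : Ω → ℝ) y := fun y =>
      Set.indicator_nonneg (fun _ _ => zero_le_one) y
    have hle1 : ∀ y, A.indicator (1 : Ω → ℝ) y ≤ 1 := fun y =>
      Set.indicator_le_self' (fun _ _ => zero_le_one) y
    set E := ∏ i ∈ Finset.range (N + 1), A.indicator (1 : Ω → ℝ) (x i) with hE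
    have hEle : E ≤ A.indicator (1 : Ω → ℝ) (x N) := by
      rw [hE, Finset.prod_range_succ]
      exact mul_le_of_le_one_left (hnn _) (Finset.prod_le_one (fun i _ => hnn _) fun i _ => hle1 _)
    have hstep : E * (1 - A.indicator (1 : Ω → ℝ) (x (N + 1)))
        ≤ A.indicator (1 : Ω → ℝ) (x N) * (1 - A.indicator (1 : Ω → ℝ) (x (N + 1))) :=
      mul_le_mul_of_nonneg_right hEle (by linarith [hle1 (x (N + 1))])
    rw [Finset.prod_range_succ, ← hE, Finset.sum_range_succ]
    calc 1 - E * A.indicator (1 : Ω → ℝ) (x (N + 1))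
        = (1 - E) + E * (1 - A.indicator (1 : Ω → ℝ) (x (N + 1))) := by ring
      _ ≤ _ := by linarith [IH, hstep]

end Pointwise

/-! ### The stationary chain: exit pairs have probability `Φ`, stays have probability `≥ a − NΦ` -/

section Chain

variable {κ : Kernel Ω Ω} [IsMarkovKernel κ] {π : Measure Ω} [IsProbabilityMeasure π] {A : Set Ω}

/-- `E_π[1_A(X_i)] = π(A)` along the stationary chain. -/
theorem chain_indicator_mean (hπ : Kernel.Invariant κ π) (hA : MeasurableSet A) (i : ℕ) :
    ∫ x, A.indicator (1 : Ω → ℝ) (x i) ∂(Kernel.trajMeasure (X := fun _ : ℕ => Ω) π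
        (fun n : ℕ => κ.comap (fun h : (j : ↥(Finset.Iic n)) → Ω => h ⟨n, Finset.mem_Iic.2 le_rfl⟩)
          (measurable_pi_apply _)))
      = π.real A := by
  have h1m : Measurable (A.indicator (1 : Ω → ℝ)) := measurable_const.indicator hA
  have h1b : ∀ y, |A.indicator (1 : Ω → ℝ) y| ≤ 1 := fun y => by
    by_cases hy : y ∈ A <;> simp [hy]
  rw [chain_marginal hπ i h1m h1b]
  exact integral_indicator_one hA

/-- **Exit pairs have probability `Φ`**: `E_π[1_A(X_i)(1 − 1_A(X_{i+1}))] = π(A) − ∫_A κ(x, A) dπ`. -/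
theorem chain_exitPair_eq_flux (hπ : Kernel.Invariant κ π) (hA : MeasurableSet A) (i : ℕ) :
    ∫ x, A.indicator (1 : Ω → ℝ) (x i) * (1 - A.indicator (1 : Ω → ℝ) (x (i + 1)))
        ∂(Kernel.trajMeasure (X := fun _ : ℕ => Ω) π
          (fun n : ℕ => κ.comap (fun h : (j : ↥(Finset.Iic n)) → Ω => h ⟨n, Finset.mem_Iic.2 le_rfl⟩)
            (measurable_pi_apply _)))
      = π.real A - ∫ x in A, (κ x).real A ∂π := by
  set P := Kernel.trajMeasure (X := fun _ : ℕ => Ω) π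
      (fun n : ℕ => κ.comap (fun h : (j : ↥(Finset.Iic n)) → Ω => h ⟨n, Finset.mem_Iic.2 le_rfl⟩)
        (measurable_pi_apply _)) with hP
  have h1m : Measurable (A.indicator (1 : Ω → ℝ)) := measurable_const.indicator hA
  have h1b : ∀ y, |A.indicator (1 : Ω → ℝ) y| ≤ 1 := fun y => by
    by_cases hy : y ∈ A <;> simp [hy]
  have hi1 : Integrable (fun x : ℕ → Ω => A.indicator (1 : Ω → ℝ) (x i)) P :=
    integrable_of_bounded P (h1m.comp (measurable_pi_apply i)) fun x => h1b (x i)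
  have hi2 : Integrable (fun x : ℕ → Ω => A.indicator (1 : Ω → ℝ) (x i)
      * A.indicator (1 : Ω → ℝ) (x (i + 1))) P :=
    integrable_of_bounded P ((h1m.comp (measurable_pi_apply i)).mul
      (h1m.comp (measurable_pi_apply (i + 1)))) (C := 1 * 1) fun x => by
      rw [abs_mul]; exact mul_le_mul (h1b _) (h1b _) (abs_nonneg _) zero_le_one
  have hpair : ∫ x, A.indicator (1 : Ω → ℝ) (x i) * A.indicator (1 : Ω → ℝ) (x (i + 1)) ∂P
      = ∫ x in A, (κ x).real A ∂π := by
    rw [hP, chain_autocov hπ h1m h1b i 1]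
    unfold autocov
    simp only [Function.iterate_one]
    exact integral_indicator_mul_kop_indicator hA
  have hexp : (fun x : ℕ → Ω => A.indicator (1 : Ω → ℝ) (x i) * (1 - A.indicator (1 : Ω → ℝ) (x (i + 1))))
      = fun x => A.indicator (1 : Ω → ℝ) (x i)
          - A.indicator (1 : Ω → ℝ) (x i) * A.indicator (1 : Ω → ℝ) (x (i + 1)) := by
    funext x; ring
  rw [hexp, integral_sub hi1 hi2, hpair, hP, chain_indicator_mean hπ hA i]

/-- **STAYING IN THE SECTOR**: for the chain started in its invariant law `π` and every `N`,
`P_π(X_0 ∈ A, …, X_N ∈ A) ≥ π(A) − N · (π(A) − ∫_A κ(x, A) dπ)`. -/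
theorem chain_stay_ge (hπ : Kernel.Invariant κ π) (hA : MeasurableSet A) (N : ℕ) :
    π.real A - N * (π.real A - ∫ x in A, (κ x).real A ∂π)
      ≤ (Kernel.trajMeasure (X := fun _ : ℕ => Ω) π
          (fun n : ℕ => κ.comap (fun h : (j : ↥(Finset.Iic n)) → Ω => h ⟨n, Finset.mem_Iic.2 le_rfl⟩)
            (measurable_pi_apply _))).real
        {x | ∀ i ∈ Finset.range (N + 1), x i ∈ A} := by
  set P := Kernel.trajMeasure (X := fun _ : ℕ => Ω) π
      (fun n : ℕ => κ.comap (fun h : (j : ↥(Finset.Iic n)) → Ω => h ⟨n, Finset.mem_Iic.2 le_rfl⟩)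
        (measurable_pi_apply _)) with hP
  set S := {x : ℕ → Ω | ∀ i ∈ Finset.range (N + 1), x i ∈ A} with hS
  have h1m : Measurable (A.indicator (1 : Ω → ℝ)) := measurable_const.indicator hA
  have h1b : ∀ y, |A.indicator (1 : Ω → ℝ) y| ≤ 1 := fun y => by
    by_cases hy : y ∈ A <;> simp [hy]
  have hSm : MeasurableSet S := by
    have : S = ⋂ i ∈ Finset.range (N + 1), (fun x : ℕ → Ω => x i) ⁻¹' A := by
      ext x; simp [hS]
    rw [this]
    exact Finset.measurableSet_biInter _ fun i _ => measurable_pi_apply i hA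
  -- the indicator of `S` is the product of the one-time indicators
  have hprod : ∀ x : ℕ → Ω, ∏ i ∈ Finset.range (N + 1), A.indicator (1 : Ω → ℝ) (x i)
      = S.indicator (1 : (ℕ → Ω) → ℝ) x := fun x => by
    by_cases hx : x ∈ S
    · rw [Set.indicator_of_mem hx, Pi.one_apply]
      exact Finset.prod_eq_one fun i hi => by rw [Set.indicator_of_mem (hx i hi), Pi.one_apply]
    · rw [Set.indicator_of_notMem hx]
      obtain ⟨i, hi, hxi⟩ : ∃ i ∈ Finset.range (N + 1), x i ∉ A := by
        by_contra hcon
        exact hx fun i hi => by_contra fun hxi => hcon ⟨i, hi, hxi⟩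
      exact Finset.prod_eq_zero hi (by rw [Set.indicator_of_notMem hxi])
  have hPS : P.real S = ∫ x, ∏ i ∈ Finset.range (N + 1), A.indicator (1 : Ω → ℝ) (x i) ∂P := by
    simp_rw [hprod]
    exact (integral_indicator_one hSm).symm
  -- integrate the pointwise first-exit bound
  have hint_prod : Integrable (fun x : ℕ → Ω => ∏ i ∈ Finset.range (N + 1), A.indicator (1 : Ω → ℝ) (x i)) P := by
    simp_rw [hprod]
    exact integrable_indicator_one hSm
  have hint0 : Integrable (fun x : ℕ → Ω => 1 - A.indicator (1 : Ω → ℝ) (x 0)) P :=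
    (integrable_const _).sub (integrable_of_bounded P (h1m.comp (measurable_pi_apply 0)) fun x => h1b (x 0))
  have hint_pair : ∀ i, Integrable (fun x : ℕ → Ω => A.indicator (1 : Ω → ℝ) (x i)
      * (1 - A.indicator (1 : Ω → ℝ) (x (i + 1)))) P := fun i =>
    integrable_of_bounded P ((h1m.comp (measurable_pi_apply i)).mul
      (measurable_const.sub (h1m.comp (measurable_pi_apply (i + 1))))) (C := 1 * 1) fun x => by
      rw [abs_mul]
      refine mul_le_mul (h1b _) ?_ (abs_nonneg _) zero_le_one
      have := h1b (x (i + 1))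
      have h0 : 0 ≤ A.indicator (1 : Ω → ℝ) (x (i + 1)) := Set.indicator_nonneg (fun _ _ => zero_le_one) _
      rw [abs_le] at this ⊢
      constructor <;> linarith [this.2]
  have hLi : Integrable (fun x : ℕ → Ω =>
      1 - ∏ i ∈ Finset.range (N + 1), A.indicator (1 : Ω → ℝ) (x i)) P :=
    (integrable_const _).sub hint_prod
  have hsum_i : Integrable (fun x : ℕ → Ω => ∑ i ∈ Finset.range N,
      A.indicator (1 : Ω → ℝ) (x i) * (1 - A.indicator (1 : Ω → ℝ) (x (i + 1)))) P :=
    integrable_finsetSum _ fun i _ => hint_pair i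
  have hRi : Integrable (fun x : ℕ → Ω => (1 - A.indicator (1 : Ω → ℝ) (x 0))
      + ∑ i ∈ Finset.range N,
          A.indicator (1 : Ω → ℝ) (x i) * (1 - A.indicator (1 : Ω → ℝ) (x (i + 1)))) P :=
    hint0.add hsum_i
  have hi0' : Integrable (fun x : ℕ → Ω => A.indicator (1 : Ω → ℝ) (x 0)) P :=
    integrable_of_bounded P (h1m.comp (measurable_pi_apply 0)) fun x => h1b (x 0)
  have hbound := integral_mono hLi hRi (fun x => one_sub_prod_indicator_le A x N)
  rw [integral_sub (integrable_const _) hint_prod, integral_add hint0 hsum_i,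
    integral_finsetSum _ (fun i _ => hint_pair i),
    integral_sub (integrable_const _) hi0', integral_const, probReal_univ, one_smul] at hbound
  simp_rw [hP, chain_exitPair_eq_flux hπ hA, chain_indicator_mean hπ hA 0] at hbound
  rw [Finset.sum_const, Finset.card_range, nsmul_eq_mul, ← hP] at hbound
  rw [hPS]
  linarith

/-- **THE FREEZING WINDOW.**  For every Markov kernel with invariant probability law `π`, every
measurable `A` and every `N`: along the chain started in `π`,
`P_π(|(1/(N+1)) Σ_{i≤N} 1_A(X_i) − π(A)| ≥ 1 − π(A)) ≥ π(A) − N · (π(A) − ∫_A κ(x, A) dπ)`. -/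
theorem chain_freezing_window (hπ : Kernel.Invariant κ π) (hA : MeasurableSet A) (N : ℕ) :
    π.real A - N * (π.real A - ∫ x in A, (κ x).real A ∂π)
      ≤ (Kernel.trajMeasure (X := fun _ : ℕ => Ω) π
          (fun n : ℕ => κ.comap (fun h : (j : ↥(Finset.Iic n)) → Ω => h ⟨n, Finset.mem_Iic.2 le_rfl⟩)
            (measurable_pi_apply _))).real
        {x | 1 - π.real A ≤ |(∑ i ∈ Finset.range (N + 1), A.indicator (1 : Ω → ℝ) (x i)) / (N + 1 : ℕ)
            - π.real A|} := by
  refine (chain_stay_ge hπ hA N).trans (measureReal_mono fun x hx => ?_)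
  simp only [Set.mem_setOf_eq] at hx ⊢
  have hsum : ∑ i ∈ Finset.range (N + 1), A.indicator (1 : Ω → ℝ) (x i) = (N + 1 : ℕ) := by
    rw [Finset.sum_congr rfl fun i hi => by rw [Set.indicator_of_mem (hx i hi), Pi.one_apply],
      Finset.sum_const, Finset.card_range, nsmul_eq_mul, mul_one]
  have hN : ((N + 1 : ℕ) : ℝ) ≠ 0 := by exact_mod_cast Nat.succ_ne_zero N
  rw [hsum, div_self hN]
  have h1 : π.real A ≤ 1 := by
    have h := measureReal_mono (μ := π) (Set.subset_univ A)
    rwa [probReal_univ] at h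
  rw [abs_of_nonneg (by linarith)]

/-- The flux form: `π(A) − ∫_A κ(x, A) dπ = (π ⊗ₘ κ)(A ×ˢ Aᶜ)` (from `flux_eq_compProd`). -/
theorem chain_freezing_window' (hπ : Kernel.Invariant κ π) (hA : MeasurableSet A) (N : ℕ) :
    π.real A - N * ((π ⊗ₘ κ) (A ×ˢ Aᶜ)).toReal
      ≤ (Kernel.trajMeasure (X := fun _ : ℕ => Ω) π
          (fun n : ℕ => κ.comap (fun h : (j : ↥(Finset.Iic n)) → Ω => h ⟨n, Finset.mem_Iic.2 le_rfl⟩)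
            (measurable_pi_apply _))).real
        {x | 1 - π.real A ≤ |(∑ i ∈ Finset.range (N + 1), A.indicator (1 : Ω → ℝ) (x i)) / (N + 1 : ℕ)
            - π.real A|} := by
  rw [← flux_eq_compProd hA]
  exact chain_freezing_window hπ hA N

end Chain

/-! ### The flow-MCMC kernel: a collapsed model freezes the run -/

section IndepMH

variable {q : Measure Ω} [IsProbabilityMeasure q] {w : Ω → ℝ} {π : Measure Ω}
  [IsProbabilityMeasure π] {A : Set Ω}

/-- **MODE COLLAPSE FREEZES THE RUN.**  For the exact flow-MCMC kernel `K = indepMH q w` with target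
`π = w · q`, every measurable sector `A` and every `N`: along the chain started in `π`,
`P_π(|(1/(N+1)) Σ_{i≤N} 1_A(U_i) − π(A)| ≥ 1 − π(A)) ≥ π(A) · (1 − N q(Aᶜ))`. -/
theorem indepMH_freezing_window (hw : Measurable w) (hw0 : ∀ x, 0 < w x)
    (hπ : (q.withDensity fun x => ENNReal.ofReal (w x)) = π) (hA : MeasurableSet A) (N : ℕ) :
    haveI : Fact (Measurable w) := ⟨hw⟩
    π.real A * (1 - N * q.real Aᶜ)
      ≤ (Kernel.trajMeasure (X := fun _ : ℕ => Ω) π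
          (fun n : ℕ => (indepMH q w).comap
            (fun h : (j : ↥(Finset.Iic n)) → Ω => h ⟨n, Finset.mem_Iic.2 le_rfl⟩) (measurable_pi_apply _))).real
        {x | 1 - π.real A ≤ |(∑ i ∈ Finset.range (N + 1), A.indicator (1 : Ω → ℝ) (x i)) / (N + 1 : ℕ)
            - π.real A|} := by
  haveI : Fact (Measurable w) := ⟨hw⟩
  have hinv : Kernel.Invariant (indepMH q w) π := by
    rw [← hπ]; exact (indepMH_isReversible hw hw0).invariant
  have hflux : ((π ⊗ₘ indepMH q w) (A ×ˢ Aᶜ)).toReal ≤ π.real A * q.real Aᶜ := by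
    rw [measureReal_def, measureReal_def, ← ENNReal.toReal_mul]
    exact ENNReal.toReal_mono (ENNReal.mul_ne_top (measure_ne_top _ _) (measure_ne_top _ _))
      (indepMH_flux_le hw hA)
  refine le_trans ?_ (chain_freezing_window' hinv hA N)
  have hN : (0 : ℝ) ≤ N := Nat.cast_nonneg N
  nlinarith [mul_le_mul_of_nonneg_left hflux hN]

end IndepMH

end Summit.Ventures.LatticeQCDFlow.Scoring

end
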